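import Summits.AtomisticToContinuum.HydrodynamicLimit.Theses.CollisionIsometryCLT
import Summits.AtomisticToContinuum.HydrodynamicLimit.Theses.StiffCollisionalRelaxation
import Summits.AtomisticToContinuum.HydrodynamicLimit.Theses.InformationPercolationEngine
import Summits.AtomisticToContinuum.HydrodynamicLimit.Theses.GermanoSplitLES
import Summits.AtomisticToContinuum.HydrodynamicLimit.Theorems.CollisionIsometryCLTCollisionalTransferLocalityDefsB
import Summits.AtomisticToContinuum.HydrodynamicLimit.Theorems.CollisionIsometryCLTCollisionalTransferLocalityDefsD
import Summits.AtomisticToContinuum.HydrodynamicLimit.Theorems.CollisionIsometryCLTCollisionalTransferLocalityChannelSplit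
import Summits.AtomisticToContinuum.HydrodynamicLimit.Theorems.CollisionIsometryCLTCollisionalTransferLocalityWeightedKineticRelaxationDilute
import Summits.AtomisticToContinuum.HydrodynamicLimit.Theorems.CollisionIsometryCLTCollisionalTransferLocalityEnergyAllTimes
import Summits.AtomisticToContinuum.HydrodynamicLimit.Theorems.CollisionIsometryCLTCollisionalTransferLocalityCompressibilityLinear
import Summits.AtomisticToContinuum.HydrodynamicLimit.Theorems.CollisionIsometryCLTCollisionalTransferLocalityVirialBoundedOfCollisionMomentBound
import Summits.AtomisticToContinuum.HydrodynamicLimit.Theorems.CollisionIsometryCLTCollisionalTransferLocalityDiluteBlocksOfKineticRangeControl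
import HarnessLib

/-!
# Assembly certificates for crux `CollisionalTransferLocality` (stmt-AtomisticToContinuum-9518) from the two engine laws
(line `hemisphere-affine-slaving`, lead gen 1 / seat c9)

Support file (`--supports stmt-AtomisticToContinuum-9518`). With the two engine statements of the crux now tree vocabulary
(`CollisionalStressLaw` [Kσ], `CollisionalEnergyFluxLaw` [Kq], file …DefsD, p140233 — the Boltzmann–Enskog marked Campbell law out of
equilibrium in the momentum and in the energy channel; research-level, taken as HYPOTHESES here) and every piece of glue landed, the
compositions of the skeleton (`Cruxes/CollisionalTransferLocality/Lines/hemisphere_affine_slaving.lean`, v17.2) become tree theorems: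

* `collisionalTransferLocalityPreShock_of_laws` — THE PRE-SHOCK FORM (`…DefsB.CollisionalTransferLocalityPreShock`, seat c1's restatement
  C′) from `StiffCollisionalRelaxation.FastMomentRelaxation` (9522) + `InformationPercolationEngine.CollisionMomentBound` (15144) +
  `GermanoSplitLES.KineticRangeControl` (9201) BY NAME + [Kσ] + [Kq]; NO `∀ t` input, NO statics;
* `collisionalTransferLocalityPreShock_of_laws_cic` — the same from the CIC route's `FastMomentRelaxationPreShock` (14902);
* `collisionalTransferLocality_of_laws` — the FILED `∀ t` decl from 9522 + 15144 + [Kσ] + [Kq] + the `∀ t` mesoscale dilute ceiling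
  [S'] (the registered stub `stub_ceilingAllTimes`, stated inline as a hypothesis; false modulo `PersistentJam`, p118982, and consumed by
  no obligation of either route — `collisionalTransferLocalityPreShock_of_allTimes` shows the filed form implies C′);
so that after the planners file [Kσ]/[Kq] as items (verbatim texts: `CollisionalStressLawInline` / `CollisionalEnergyFluxLawInline`,
DefsD) and restate 9518 := C′, the item is proved by `collisionalTransferLocalityPreShock_of_laws`. All proofs are the skeleton's, verbatim.
-/

namespace Summit.AtomisticToContinuum.HydrodynamicLimit.Theorems.HemisphereAffineSlaving

open scoped BigOperators Topology Classical ENNReal InnerProductSpace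
open Filter Set Function MeasureTheory

noncomputable section

open Literature.MathematicalPhysics.KineticTheory (T3 V3)

/-- **ASSEMBLY CERTIFICATE — the PRE-SHOCK form of the crux from named route items and the two engine laws.** From the Stiff route's
`∀ t` kinetic hinge 9522 (`FastMomentRelaxation`), the collision-moment tightness 15144 (`InformationPercolationEngine.CollisionMomentBound` ⇒ [V],
`virialBounded_of_collisionMomentBound`) and the kinetic range control 9201 (`GermanoSplitLES.KineticRangeControl` ⇒ [D],
`stub_diluteBlocks_of_kineticRangeControl`) BY NAME, the two engine laws `CollisionalStressLaw` [Kσ] and `CollisionalEnergyFluxLaw` [Kq]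
(DefsD; research statements, hypotheses here), and LANDED glue only — the channel split `conclusion_of_channels` (p139580; [S1] +
`stub_markedReduction` + [G2] `stub_channelAdditivity`), [C]° `stub_weightedKineticRelaxationDilute`, [E] `stub_energyAllTimes`, [Z]
`stub_hsCompressibility_linear`:
`CollisionalTransferLocalityPreShock` with the dilute level `η⋆ := min (min η_Z ηbar) (min η_ψ η_χ)` (`ηbar` from [D], `η_ψ, η_χ` from [Kσ], [Kq]) as the
chamber level and `σ₀ := min (σ_9522, σ_15144, σ_[Kσ], σ_[Kq], σ_[D], 1/2)`. NO `∀ t` stub, NO statics. -/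
theorem collisionalTransferLocalityPreShock_of_laws : Summit.AtomisticToContinuum.HydrodynamicLimit.Theses.StiffCollisionalRelaxation.FastMomentRelaxation → Summit.AtomisticToContinuum.HydrodynamicLimit.Theses.InformationPercolationEngine.CollisionMomentBound → CollisionalStressLaw → CollisionalEnergyFluxLaw → Summit.AtomisticToContinuum.HydrodynamicLimit.Theses.GermanoSplitLES.KineticRangeControl → CollisionalTransferLocalityPreShock := by
  intro hF hM hKσ hKq hK a₀ θ₀ u₀ ha hθ hu ha0 hθ0
  have hP : NiceProfiles a₀ θ₀ u₀ := ⟨ha, hθ, hu, ha0, hθ0⟩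
  obtain ⟨ηZ, hηZ, K, hK0, hZK⟩ := Summit.AtomisticToContinuum.HydrodynamicLimit.Theorems.HemisphereAffineSlaving.stub_hsCompressibility_linear
  obtain ⟨ηbar, hηbar, HD0⟩ := stub_diluteBlocks_of_kineticRangeControl hK a₀ θ₀ u₀ hP
  obtain ⟨σBψ, hσBψ, ηψ, hηψ, HBψ⟩ := hKσ a₀ θ₀ u₀ hP
  obtain ⟨σBχ, hσBχ, ηχ, hηχ, HBχ⟩ := hKq a₀ θ₀ u₀ hP
  set ηs : ℝ := min (min ηZ ηbar) (min ηψ ηχ) with hηs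
  have hηs0 : 0 < ηs := lt_min (lt_min hηZ hηbar) (lt_min hηψ hηχ)
  have hηsZ : ηs ≤ ηZ := (min_le_left _ _).trans (min_le_left _ _)
  have hηs2 : ηs ≤ ηbar := (min_le_left _ _).trans (min_le_right _ _)
  have hηsψ : ηs ≤ ηψ := (min_le_right _ _).trans (min_le_left _ _)
  have hηsχ : ηs ≤ ηχ := (min_le_right _ _).trans (min_le_right _ _)
  obtain ⟨σF, hσF, HF⟩ := hF a₀ θ₀ u₀ ha hθ hu ha0 hθ0
  obtain ⟨σV, hσV, HV⟩ := virialBounded_of_collisionMomentBound hM a₀ θ₀ u₀ hP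
  obtain ⟨σD, hσD, HD⟩ := HD0 ηs hηs0 hηs2
  have HC := Summit.AtomisticToContinuum.HydrodynamicLimit.Theorems.HemisphereAffineSlaving.stub_weightedKineticRelaxationDilute ηZ K hηZ hK0 hZK ηs hηs0 hηsZ
  have HE := Summit.AtomisticToContinuum.HydrodynamicLimit.Theorems.HemisphereAffineSlaving.stub_energyAllTimes a₀ θ₀ u₀ hP
  refine ⟨min (min σF σV) (min (min σBψ σBχ) (min σD (1 / 2))), ?_, ηs, hηs0, ?_⟩
  · exact lt_min (lt_min hσF hσV) (lt_min (lt_min hσBψ hσBχ) (lt_min hσD (by norm_num)))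
  intro σ hσ hlt T ρ θ u hsol Φ hlln γ C φ hγ hγ' hadm
  have hltF : σ < σF := lt_of_lt_of_le hlt ((min_le_left _ _).trans (min_le_left _ _))
  have hltV : σ < σV := lt_of_lt_of_le hlt ((min_le_left _ _).trans (min_le_right _ _))
  have hltBψ : σ < σBψ := lt_of_lt_of_le hlt
    ((min_le_right _ _).trans ((min_le_left _ _).trans (min_le_left _ _)))
  have hltBχ : σ < σBχ := lt_of_lt_of_le hlt
    ((min_le_right _ _).trans ((min_le_left _ _).trans (min_le_right _ _)))
  have hltD : σ < σD := lt_of_lt_of_le hlt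
    ((min_le_right _ _).trans ((min_le_right _ _).trans (min_le_left _ _)))
  have hhalf : σ ≤ 1 / 2 :=
    (lt_of_lt_of_le hlt ((min_le_right _ _).trans ((min_le_right _ _).trans (min_le_right _ _)))).le
  obtain ⟨E₀, -, HEt⟩ := HE σ hσ hhalf Φ
  intro ρb mb Eb ub θb pc t ht htT hdil ψ χ hψ hχ O Cc' δ hδ
  have hEner := HEt t
  have hDil : DiluteAt σ a₀ θ₀ u₀ Φ t φ ηs :=
    HD σ hσ hltD T ρ θ u hsol Φ hlln t ht htT hdil γ C φ hγ hγ' hadm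
  have hVir : VirialBounded σ a₀ θ₀ u₀ Φ t := HV σ hσ hltV Φ t ht
  have hFloc : ∀ δ : ℝ, 0 < δ → Tendsto (fun N : ℕ =>
      Literature.MathematicalPhysics.KineticTheory.localGibbsLaw σ a₀ u₀ θ₀ N (Φ N)
        {z | δ < ∫ s in Icc 0 t, ∫ x, ((∑ j, ∑ k, Dst φ N ((Φ N).flow s z) x j k ^ 2) +
          ‖qfl φ N ((Φ N).flow s z) x‖ ^ 2)}) atTop (𝓝 0) :=
    fun δ hδ => HF σ hσ hltF Φ γ C φ hγ hγ' hadm t ht δ hδ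
  have hφc : ∀ N, Continuous (φ N) := fun N => (hadm.1 N).continuous
  have hφ0 : ∀ N y, 0 ≤ φ N y := hadm.2.1
  have h0χ := isSmoothSpaceTimeOn_zero_scalar (Icc 0 t)
  have h0ψ := isSmoothSpaceTimeOn_zero_vector (Icc 0 t)
  exact conclusion_of_channels hσ hhalf hηZ hK0 hZK hηs0 hηsZ a₀ θ₀ u₀ Φ φ ht hφc hφ0 hDil hψ hχ hVir
    (HBψ σ hσ hltBψ Φ t ht hVir γ C φ hγ hγ' hadm (hDil.mono hηsψ) ψ hψ)
    (HBχ σ hσ hltBχ Φ t ht hVir γ C φ hγ hγ' hadm (hDil.mono hηsχ) χ hχ)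
    (HC σ hσ a₀ θ₀ u₀ Φ t E₀ ht hEner γ C φ hγ hγ' hadm hDil hFloc ψ _ hψ h0χ)
    (HC σ hσ a₀ θ₀ u₀ Φ t E₀ ht hEner γ C φ hγ hγ' hadm hDil hFloc _ χ h0ψ hχ) δ hδ

/-- **ASSEMBLY CERTIFICATE (CIC twin) — the pre-shock form from the CIC route's own pre-shock hinge** 14902
(`FastMomentRelaxationPreShock`, the time-local kinetic closure per `t < T` in its chamber `η₁(14902)`), the shared 15144 (⇒ [V]) and
9201 (⇒ [D]), the two engine laws and landed glue: chamber level `η₁ := min η₁(14902) η⋆`. -/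
theorem collisionalTransferLocalityPreShock_of_laws_cic
    (hF : Summit.AtomisticToContinuum.HydrodynamicLimit.Theses.CollisionIsometryCLT.FastMomentRelaxationPreShock)
    (hM : Summit.AtomisticToContinuum.HydrodynamicLimit.Theses.InformationPercolationEngine.CollisionMomentBound)
    (hKσ : CollisionalStressLaw) (hKq : CollisionalEnergyFluxLaw)
    (hK : Summit.AtomisticToContinuum.HydrodynamicLimit.Theses.GermanoSplitLES.KineticRangeControl) :
    CollisionalTransferLocalityPreShock := by
  intro a₀ θ₀ u₀ ha hθ hu ha0 hθ0
  have hP : NiceProfiles a₀ θ₀ u₀ := ⟨ha, hθ, hu, ha0, hθ0⟩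
  obtain ⟨ηZ, hηZ, K, hK0, hZK⟩ := Summit.AtomisticToContinuum.HydrodynamicLimit.Theorems.HemisphereAffineSlaving.stub_hsCompressibility_linear
  obtain ⟨ηbar, hηbar, HD0⟩ := stub_diluteBlocks_of_kineticRangeControl hK a₀ θ₀ u₀ hP
  obtain ⟨σBψ, hσBψ, ηψ, hηψ, HBψ⟩ := hKσ a₀ θ₀ u₀ hP
  obtain ⟨σBχ, hσBχ, ηχ, hηχ, HBχ⟩ := hKq a₀ θ₀ u₀ hP
  set ηs : ℝ := min (min ηZ ηbar) (min ηψ ηχ) with hηs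
  have hηs0 : 0 < ηs := lt_min (lt_min hηZ hηbar) (lt_min hηψ hηχ)
  have hηsZ : ηs ≤ ηZ := (min_le_left _ _).trans (min_le_left _ _)
  have hηs2 : ηs ≤ ηbar := (min_le_left _ _).trans (min_le_right _ _)
  have hηsψ : ηs ≤ ηψ := (min_le_right _ _).trans (min_le_left _ _)
  have hηsχ : ηs ≤ ηχ := (min_le_right _ _).trans (min_le_right _ _)
  obtain ⟨σF, hσF, ηF, hηF, HF⟩ := hF a₀ θ₀ u₀ ha hθ hu ha0 hθ0
  obtain ⟨σV, hσV, HV⟩ := virialBounded_of_collisionMomentBound hM a₀ θ₀ u₀ hP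
  obtain ⟨σD, hσD, HD⟩ := HD0 ηs hηs0 hηs2
  have HC := Summit.AtomisticToContinuum.HydrodynamicLimit.Theorems.HemisphereAffineSlaving.stub_weightedKineticRelaxationDilute ηZ K hηZ hK0 hZK ηs hηs0 hηsZ
  have HE := Summit.AtomisticToContinuum.HydrodynamicLimit.Theorems.HemisphereAffineSlaving.stub_energyAllTimes a₀ θ₀ u₀ hP
  refine ⟨min (min σF σV) (min (min σBψ σBχ) (min σD (1 / 2))), ?_, min ηF ηs, lt_min hηF hηs0, ?_⟩
  · exact lt_min (lt_min hσF hσV) (lt_min (lt_min hσBψ hσBχ) (lt_min hσD (by norm_num)))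
  intro σ hσ hlt T ρ θ u hsol Φ hlln γ C φ hγ hγ' hadm
  have hltF : σ < σF := lt_of_lt_of_le hlt ((min_le_left _ _).trans (min_le_left _ _))
  have hltV : σ < σV := lt_of_lt_of_le hlt ((min_le_left _ _).trans (min_le_right _ _))
  have hltBψ : σ < σBψ := lt_of_lt_of_le hlt
    ((min_le_right _ _).trans ((min_le_left _ _).trans (min_le_left _ _)))
  have hltBχ : σ < σBχ := lt_of_lt_of_le hlt
    ((min_le_right _ _).trans ((min_le_left _ _).trans (min_le_right _ _)))
  have hltD : σ < σD := lt_of_lt_of_le hlt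
    ((min_le_right _ _).trans ((min_le_right _ _).trans (min_le_left _ _)))
  have hhalf : σ ≤ 1 / 2 :=
    (lt_of_lt_of_le hlt ((min_le_right _ _).trans ((min_le_right _ _).trans (min_le_right _ _)))).le
  obtain ⟨E₀, -, HEt⟩ := HE σ hσ hhalf Φ
  intro ρb mb Eb ub θb pc t ht htT hdil ψ χ hψ hχ O Cc' δ hδ
  have hdilF : ∀ s ∈ Icc 0 t, ∀ x, 2 * ρ s x * σ ^ 3 < ηF :=
    fun s hs x => (hdil s hs x).trans_le (min_le_left _ _)
  have hdil2 : ∀ s ∈ Icc 0 t, ∀ x, 2 * ρ s x * σ ^ 3 < ηs :=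
    fun s hs x => (hdil s hs x).trans_le (min_le_right _ _)
  have hEner := HEt t
  have hDil : DiluteAt σ a₀ θ₀ u₀ Φ t φ ηs :=
    HD σ hσ hltD T ρ θ u hsol Φ hlln t ht htT hdil2 γ C φ hγ hγ' hadm
  have hVir : VirialBounded σ a₀ θ₀ u₀ Φ t := HV σ hσ hltV Φ t ht
  have hFloc : ∀ δ : ℝ, 0 < δ → Tendsto (fun N : ℕ =>
      Literature.MathematicalPhysics.KineticTheory.localGibbsLaw σ a₀ u₀ θ₀ N (Φ N)
        {z | δ < ∫ s in Icc 0 t, ∫ x, ((∑ j, ∑ k, Dst φ N ((Φ N).flow s z) x j k ^ 2) +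
          ‖qfl φ N ((Φ N).flow s z) x‖ ^ 2)}) atTop (𝓝 0) :=
    fun δ hδ => HF σ hσ hltF T ρ θ u hsol Φ hlln γ C φ hγ hγ' hadm t ht htT hdilF δ hδ
  have hφc : ∀ N, Continuous (φ N) := fun N => (hadm.1 N).continuous
  have hφ0 : ∀ N y, 0 ≤ φ N y := hadm.2.1
  have h0χ := isSmoothSpaceTimeOn_zero_scalar (Icc 0 t)
  have h0ψ := isSmoothSpaceTimeOn_zero_vector (Icc 0 t)
  exact conclusion_of_channels hσ hhalf hηZ hK0 hZK hηs0 hηsZ a₀ θ₀ u₀ Φ φ ht hφc hφ0 hDil hψ hχ hVir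
    (HBψ σ hσ hltBψ Φ t ht hVir γ C φ hγ hγ' hadm (hDil.mono hηsψ) ψ hψ)
    (HBχ σ hσ hltBχ Φ t ht hVir γ C φ hγ hγ' hadm (hDil.mono hηsχ) χ hχ)
    (HC σ hσ a₀ θ₀ u₀ Φ t E₀ ht hEner γ C φ hγ hγ' hadm hDil hFloc ψ _ hψ h0χ)
    (HC σ hσ a₀ θ₀ u₀ Φ t E₀ ht hEner γ C φ hγ hγ' hadm hDil hFloc _ χ h0ψ hχ) δ hδ

/-- The filed `∀ t > 0` crux implies the pre-shock form (pure logic, `η₁ := 1`): the restatement is a WEAKENING, so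
nothing landed for the line is invalidated by it. -/
theorem collisionalTransferLocalityPreShock_of_allTimes
    (h : Summit.AtomisticToContinuum.HydrodynamicLimit.Theses.StiffCollisionalRelaxation.CollisionalTransferLocality) :
    CollisionalTransferLocalityPreShock := by
  intro a₀ θ₀ u₀ ha hθ hu ha0 hθ0
  obtain ⟨σ₀, hσ₀, H⟩ := h a₀ θ₀ u₀ ha hθ hu ha0 hθ0
  refine ⟨σ₀, hσ₀, 1, one_pos, ?_⟩
  intro σ hσ hσ' T ρ θ u _sol Φ _lln γ C φ hγ hγ' hadm ρb mb Eb ub θb pc t ht _htT _hdil ψ χ hψ hχ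
  exact H σ hσ hσ' Φ γ C φ hγ hγ' hadm t ht ψ χ hψ hχ

/-- **ASSEMBLY CERTIFICATE — the FILED `∀ t` crux decl (`StiffCollisionalRelaxation.CollisionalTransferLocality`, `rfl`-equal to the
CIC decl) from 9522 + 15144 BY NAME, the two engine laws and the `∀ t` dilute ceiling [S'] (hypotheses; [S'] inline), landed glue only**
(verbatim the skeleton theorem `CollisionalTransferLocality_of` of v17.2; its docstring follows). From the Stiff route's `∀ t` kinetic hinge 9522 (`FastMomentRelaxation`)
and the collision-moment tightness item 15144 (`InformationPercolationEngine.CollisionMomentBound`, which gives [V] —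
`virialBounded_of_collisionMomentBound`) BY NAME, the two ENGINE stubs [Kσ] `stub_collisionalStressLaw` and [Kq]
`stub_collisionalEnergyFluxLaw` (research; dilute levels `η_ψ`, `η_χ`), the provable glue [G2] `stub_channelAdditivity`, the landed
reduction (`conclusion_of_channels`), the landed stubs [C]° (once per channel), [E], [Z], and the one `∀ t` a-priori stub [S'] at the
dilute level `η⋆ := min η_Z (min η_ψ η_χ)` (`DiluteAt` is monotone in the level, `DiluteAt.mono`):
`σ₀ := min (min σ_9522 σ_15144) (min (min σ_[Kσ] σ_[Kq]) (min σ_[S'] (1/2)))`. No statics enter the composition any more (the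
contact theorem and `Z` sit inside [Kσ]/[Kq]). The conclusion at `(σ, profiles, Φ)` is definitionally the crux's `let`-telescope
(`conclusionAtFlow_iff`). -/
theorem collisionalTransferLocality_of_laws
    (hF : Summit.AtomisticToContinuum.HydrodynamicLimit.Theses.StiffCollisionalRelaxation.FastMomentRelaxation)
    (hM : Summit.AtomisticToContinuum.HydrodynamicLimit.Theses.InformationPercolationEngine.CollisionMomentBound)
    (hKσ : CollisionalStressLaw) (hKq : CollisionalEnergyFluxLaw)
    (hS : ∀ η₁ : ℝ, 0 < η₁ → ∀ (a₀ θ₀ : T3 → ℝ) (u₀ : T3 → V3), NiceProfiles a₀ θ₀ u₀ → ∃ σ₀ : ℝ, 0 < σ₀ ∧ ∀ σ : ℝ, 0 < σ → σ < σ₀ → ∀ (Φ : Flows σ) (t : ℝ), 0 < t → ∀ (γ C : ℝ) (φ : ℕ → T3 → ℝ), 0 < γ → γ ≤ 1 / 15 → AdmissibleKernel γ C φ → DiluteAt σ a₀ θ₀ u₀ Φ t φ η₁) :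
    Summit.AtomisticToContinuum.HydrodynamicLimit.Theses.StiffCollisionalRelaxation.CollisionalTransferLocality := by
  intro a₀ θ₀ u₀ ha hθ hu ha0 hθ0
  have hP : NiceProfiles a₀ θ₀ u₀ := ⟨ha, hθ, hu, ha0, hθ0⟩
  obtain ⟨ηZ, hηZ, K, hK0, hZK⟩ := Summit.AtomisticToContinuum.HydrodynamicLimit.Theorems.HemisphereAffineSlaving.stub_hsCompressibility_linear
  obtain ⟨σF, hσF, HF⟩ := hF a₀ θ₀ u₀ ha hθ hu ha0 hθ0
  obtain ⟨σV, hσV, HV⟩ := virialBounded_of_collisionMomentBound hM a₀ θ₀ u₀ hP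
  obtain ⟨σBψ, hσBψ, ηψ, hηψ, HBψ⟩ := hKσ a₀ θ₀ u₀ hP
  obtain ⟨σBχ, hσBχ, ηχ, hηχ, HBχ⟩ := hKq a₀ θ₀ u₀ hP
  set ηs : ℝ := min ηZ (min ηψ ηχ) with hηs
  have hηs0 : 0 < ηs := lt_min hηZ (lt_min hηψ hηχ)
  have hηsZ : ηs ≤ ηZ := min_le_left _ _
  have hηsψ : ηs ≤ ηψ := (min_le_right _ _).trans (min_le_left _ _)
  have hηsχ : ηs ≤ ηχ := (min_le_right _ _).trans (min_le_right _ _)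
  obtain ⟨σS, hσS, HS⟩ := hS ηs hηs0 a₀ θ₀ u₀ hP
  have HC := Summit.AtomisticToContinuum.HydrodynamicLimit.Theorems.HemisphereAffineSlaving.stub_weightedKineticRelaxationDilute ηZ K hηZ hK0 hZK ηs hηs0 hηsZ
  have HE := Summit.AtomisticToContinuum.HydrodynamicLimit.Theorems.HemisphereAffineSlaving.stub_energyAllTimes a₀ θ₀ u₀ hP
  refine ⟨min (min σF σV) (min (min σBψ σBχ) (min σS (1 / 2))), ?_, ?_⟩
  · exact lt_min (lt_min hσF hσV) (lt_min (lt_min hσBψ hσBχ) (lt_min hσS (by norm_num)))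
  intro σ hσ hlt
  have hltF : σ < σF := lt_of_lt_of_le hlt ((min_le_left _ _).trans (min_le_left _ _))
  have hltV : σ < σV := lt_of_lt_of_le hlt ((min_le_left _ _).trans (min_le_right _ _))
  have hltBψ : σ < σBψ := lt_of_lt_of_le hlt
    ((min_le_right _ _).trans ((min_le_left _ _).trans (min_le_left _ _)))
  have hltBχ : σ < σBχ := lt_of_lt_of_le hlt
    ((min_le_right _ _).trans ((min_le_left _ _).trans (min_le_right _ _)))
  have hltS : σ < σS := lt_of_lt_of_le hlt
    ((min_le_right _ _).trans ((min_le_right _ _).trans (min_le_left _ _)))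
  have hhalf : σ ≤ 1 / 2 :=
    (lt_of_lt_of_le hlt ((min_le_right _ _).trans ((min_le_right _ _).trans (min_le_right _ _)))).le
  intro Φ
  obtain ⟨E₀, -, HEt⟩ := HE σ hσ hhalf Φ
  show ConclusionAtFlow σ a₀ θ₀ u₀ Φ
  rw [conclusionAtFlow_iff]
  intro γ C φ hγ hγ' hadm t ht ψ χ hψ hχ
  have hEner := HEt t
  have hDil : DiluteAt σ a₀ θ₀ u₀ Φ t φ ηs := HS σ hσ hltS Φ t ht γ C φ hγ hγ' hadm
  have hVir : VirialBounded σ a₀ θ₀ u₀ Φ t := HV σ hσ hltV Φ t ht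
  have hφc : ∀ N, Continuous (φ N) := fun N => (hadm.1 N).continuous
  have hφ0 : ∀ N y, 0 ≤ φ N y := hadm.2.1
  have hFloc : ∀ δ : ℝ, 0 < δ → Tendsto (fun N : ℕ =>
      Literature.MathematicalPhysics.KineticTheory.localGibbsLaw σ a₀ u₀ θ₀ N (Φ N)
        {z | δ < ∫ s in Icc 0 t, ∫ x, ((∑ j, ∑ k, Dst φ N ((Φ N).flow s z) x j k ^ 2) +
          ‖qfl φ N ((Φ N).flow s z) x‖ ^ 2)}) atTop (𝓝 0) :=
    fun δ hδ => HF σ hσ hltF Φ γ C φ hγ hγ' hadm t ht δ hδ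
  have h0χ := isSmoothSpaceTimeOn_zero_scalar (Icc 0 t)
  have h0ψ := isSmoothSpaceTimeOn_zero_vector (Icc 0 t)
  exact conclusion_of_channels hσ hhalf hηZ hK0 hZK hηs0 hηsZ a₀ θ₀ u₀ Φ φ ht hφc hφ0 hDil hψ hχ hVir
    (HBψ σ hσ hltBψ Φ t ht hVir γ C φ hγ hγ' hadm (hDil.mono hηsψ) ψ hψ)
    (HBχ σ hσ hltBχ Φ t ht hVir γ C φ hγ hγ' hadm (hDil.mono hηsχ) χ hχ)
    (HC σ hσ a₀ θ₀ u₀ Φ t E₀ ht hEner γ C φ hγ hγ' hadm hDil hFloc ψ _ hψ h0χ)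
    (HC σ hσ a₀ θ₀ u₀ Φ t E₀ ht hEner γ C φ hγ hγ' hadm hDil hFloc _ χ h0ψ hχ)


end

end Summit.AtomisticToContinuum.HydrodynamicLimit.Theorems.HemisphereAffineSlaving
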